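import Summits.BirchSwinnertonDyer.BirchSwinnertonDyer.Theorems.Rank2ObservatoryCubicFieldR1298700
import HarnessLib

/-!
# BirchSwinnertonDyer — rank ≥ 2 observatory: class number one of the cubic field of `-32 + 117 * X - 24 * X ^ 2 + X ^ 3` (`Δ = 1298700`) — certificates at the primes 311, 313, 317

HONEST FRAMING: per-curve certified theorems and census instruments; no claim on BSD in rank ≥ 2.

Companion of the per-FIELD file `Rank2ObservatoryCubicFieldR1298700` of the KERNEL-2DESC instrument (design
`b2b-bsdr2-cert-3/KERNEL-2DESC.md` §9e–§9g): the degree-one prime-element certificates at the primes 311, 313, 317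
(part c). Split off for file size; generated by the same generator from the same checked data.
Sorry-free; axioms `propext`, `Classical.choice`, `Quot.sound`.
[cite: Marcus2018, Ch. 3 Thm. 27, Ch. 5 Cor. 2 of Thm. 37]
-/

-- single-conjunct summit: `Summit.BirchSwinnertonDyer.BirchSwinnertonDyer.…` repeats the name by design
set_option linter.dupNamespace false

noncomputable section

open scoped Classical NumberField

open Literature.NumberTheory.NumberFields Polynomial Module NumberField

namespace Summit.BirchSwinnertonDyer.BirchSwinnertonDyer.Rank2Observatory.TwoDescCubic

namespace FieldR1298700

/-! ## Class number one -/

/-- Certificate at `311`: every ring map `ψ : 𝓞 K → ℤ/311` kills a prime element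
(`α ↦ 136`: `-525 + 1837 * α - 105 * α ^ 2` (norm `311`)). [cite: Marcus2018, Ch. 3, Thm. 27] -/
theorem cert311 (ψ : 𝓞 (CubicField (-24) 117 (-32)) →+* ZMod 311) : ∃ e : 𝓞 (CubicField (-24) 117 (-32)), ψ e = 0 ∧ Prime e := by
  refine cert_of_cases aeval_α ψ (fun t ht hF => ?_)
  have hroots : ∀ t : ZMod 311,
      t ^ 3 + (((-24) : ℤ) : ZMod 311) * t ^ 2 + ((117 : ℤ) : ZMod 311) * t + (((-32) : ℤ) : ZMod 311) = 0 → t = 136 := by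
    decide +kernel
  obtain rfl := hroots t hF
  exact ⟨lin aeval_α (-525) 1837 (-105), by simp only [lin, map_add, map_mul, map_pow, map_intCast, ht]; decide,
      lin_prime_of_prime irreducible aeval_α finrank_eq (-525) 1837 (-105) (n := 311)
        (by norm_num [MonicCubic.normForm]) (by norm_num)⟩

/-- Certificate at `313`: every ring map `ψ : 𝓞 K → ℤ/313` kills a prime element
(`α ↦ 310`: `-11623 + 40656 * α - 2302 * α ^ 2` (norm `313`)). [cite: Marcus2018, Ch. 3, Thm. 27] -/
theorem cert313 (ψ : 𝓞 (CubicField (-24) 117 (-32)) →+* ZMod 313) : ∃ e : 𝓞 (CubicField (-24) 117 (-32)), ψ e = 0 ∧ Prime e := by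
  refine cert_of_cases aeval_α ψ (fun t ht hF => ?_)
  have hroots : ∀ t : ZMod 313,
      t ^ 3 + (((-24) : ℤ) : ZMod 313) * t ^ 2 + ((117 : ℤ) : ZMod 313) * t + (((-32) : ℤ) : ZMod 313) = 0 → t = 310 := by
    decide +kernel
  obtain rfl := hroots t hF
  exact ⟨lin aeval_α (-11623) 40656 (-2302), by simp only [lin, map_add, map_mul, map_pow, map_intCast, ht]; decide,
      lin_prime_of_prime irreducible aeval_α finrank_eq (-11623) 40656 (-2302) (n := 313)
        (by norm_num [MonicCubic.normForm]) (by norm_num)⟩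

/-- Certificate at `317`: `g` has no root mod `317`, so there is no ring map `𝓞 K → ℤ/317`. [folklore] -/
theorem cert317 (ψ : 𝓞 (CubicField (-24) 117 (-32)) →+* ZMod 317) : ∃ e : 𝓞 (CubicField (-24) 117 (-32)), ψ e = 0 ∧ Prime e :=
  cert_of_no_root aeval_α ψ (by decide +kernel)

end FieldR1298700

end Summit.BirchSwinnertonDyer.BirchSwinnertonDyer.Rank2Observatory.TwoDescCubic

end
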